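import Summits.Ventures.PercRepro.C026TwoHubOpenMain

/-!
# THEOREM B, the counting corollaries: the sharp `(3/2)` count and `(E00)` on the two-hub classes
(p6, gen 22)

ROW C-041's chain (MINE3-GLUING.md §40 (b)): `(G⅔)` + the Φ-matching `#Good_a + #Good_b ≤ |B|`
(C026GoodDegreeBridge, `card_good_add_good_le`) give the SHARP COUNT `2·n(D,A) ≤ 3·|B|` — tight on
the hub, the 6-core and W9 — hence `n(D,A) ≤ 2·|B|` and the corner identity `(E00)`.  On the two-hub
classes all of this is now unconditional:

* `twoHub_sharp_count`, `twoHubOpen_sharp_count` — `2·n(D,A) ≤ 3·|B|` (`|B|` = the configurations in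
  which `c` is red-joined to exactly one live vertex);
* `twoHub_E00`, `twoHubOpen_E00` — the all-corner value `(P)(0,0) = 2·Δ_CF + n(D,·)` is nonnegative,
  i.e. `n(D,A) ≤ 2|B| + 2n(B,C) + n(D,¬A)` (the `(E00)` of THEOREM L2, via
  `pFun_liveCells_nonneg_of_goodDegree`).
-/

namespace PercRepro

namespace MultiGraph

open Finset

variable {V E : Type*} {G : MultiGraph V E} {a b h h' c : V}

section Corollaries

variable [Fintype E] [DecidableEq E]
variable (hab : a ≠ b) (hca : c ≠ a) (hcb : c ≠ b) (hha : h ≠ a) (hhb : h ≠ b) (hh'a : h' ≠ a)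
  (hh'b : h' ≠ b) (hisoa : ∀ e, G.fst e ≠ a ∧ G.snd e ≠ a) (hisob : ∀ e, G.fst e ≠ b ∧ G.snd e ≠ b)

include hab hca hcb hha hhb hh'a hh'b hisoa hisob in
open Classical in
/-- **The sharp count on the two-hub class**: `2·n(D,A) ≤ 3·|B|` (tight on the hub, the 6-core and
W9). -/
theorem twoHub_sharp_count :
    2 * (univ.filter fun S : Config (E ⊕ Fin 5) =>
        ((G.attachTwoHub a b h h').Conn S c a ∧ (G.attachTwoHub a b h h').Conn S c b) ∧
        (¬ (G.attachTwoHub a b h h').Conn Sᶜ c a ∧ ¬ (G.attachTwoHub a b h h').Conn Sᶜ c b ∧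
          ¬ (G.attachTwoHub a b h h').Conn Sᶜ a b)).card ≤
      3 * (univ.filter fun T : Config (E ⊕ Fin 5) =>
        ((G.attachTwoHub a b h h').Conn T c a ∧ ¬ (G.attachTwoHub a b h h').Conn T c b) ∨
          ((G.attachTwoHub a b h h').Conn T c b ∧ ¬ (G.attachTwoHub a b h h').Conn T c a)).card :=
  card_DA_le_of_goodDegree a b c (twoHub_goodDegree hab hca hcb hha hhb hh'a hh'b hisoa hisob)

include hab hca hcb hha hhb hh'a hh'b hisoa hisob in
open Classical in
/-- **The sharp count on the two-hub class with non-adjacent terminals**. -/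
theorem twoHubOpen_sharp_count :
    2 * (univ.filter fun S : Config (E ⊕ Fin 4) =>
        ((G.attachTwoHubOpen a b h h').Conn S c a ∧ (G.attachTwoHubOpen a b h h').Conn S c b) ∧
        (¬ (G.attachTwoHubOpen a b h h').Conn Sᶜ c a ∧ ¬ (G.attachTwoHubOpen a b h h').Conn Sᶜ c b ∧
          ¬ (G.attachTwoHubOpen a b h h').Conn Sᶜ a b)).card ≤
      3 * (univ.filter fun T : Config (E ⊕ Fin 4) =>
        ((G.attachTwoHubOpen a b h h').Conn T c a ∧ ¬ (G.attachTwoHubOpen a b h h').Conn T c b) ∨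
          ((G.attachTwoHubOpen a b h h').Conn T c b ∧
            ¬ (G.attachTwoHubOpen a b h h').Conn T c a)).card :=
  card_DA_le_of_goodDegree a b c (twoHubOpen_goodDegree hab hca hcb hha hhb hh'a hh'b hisoa hisob)

include hab hca hcb hha hhb hh'a hh'b hisoa hisob in
open Classical in
/-- **`(E00)` on the two-hub class**: the all-corner value of `(P)` is nonnegative. -/
theorem twoHub_E00 [Fintype V] [DecidableEq V] :
    0 ≤ (G.attachTwoHub a b h h').pFun c (liveCells a b) (liveCells a b) univ :=
  pFun_liveCells_nonneg_of_goodDegree a b c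
    (twoHub_goodDegree hab hca hcb hha hhb hh'a hh'b hisoa hisob)

include hab hca hcb hha hhb hh'a hh'b hisoa hisob in
open Classical in
/-- **`(E00)` on the two-hub class with non-adjacent terminals**. -/
theorem twoHubOpen_E00 [Fintype V] [DecidableEq V] :
    0 ≤ (G.attachTwoHubOpen a b h h').pFun c (liveCells a b) (liveCells a b) univ :=
  pFun_liveCells_nonneg_of_goodDegree a b c
    (twoHubOpen_goodDegree hab hca hcb hha hhb hh'a hh'b hisoa hisob)

end Corollaries

end MultiGraph

end PercRepro
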